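import Summits.AtomisticToContinuum.HydrodynamicLimit.Theorems.KineticFluxLdDecay.Negative.TiltBasics
import Summits.AtomisticToContinuum.HydrodynamicLimit.Theorems.OneFlightGossipEngineKineticCurrentsWindowLDApriori
import Literature.Analysis.FluidPDE.HardSphereFlowJointMeasurable

/-!
# `EquilibriumShearWindowLD`: window exponential moments are dominated by the static one
# (route TwoClocks, stmt-AtomisticToContinuum-14446; static sandwich, part 1 — upper side)

Helper file (`--supports`) for the support item `TwoClocks.EquilibriumShearWindowLD`
(stmt-AtomisticToContinuum-14446): the finite-kinetic-window large-deviation bound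
`M_N(β, τ) := ∫ exp(β ∑ᵢ w⁻¹∫₀ʷ φ(xᵢ(r)) vᵢ⁰(r) vᵢ¹(r) dr) dG_N ≤ exp(ε(N+1))`, `w = τ(N+1)^{-1/3}`,
for the kinetic shear stress of `N + 1` hard spheres at fixed small reduced density under the global
canonical Gibbs law `G_N = localGibbsLaw σ a₀ 0 θ₀ N Φ`. The item itself — decorrelation of the
kinetic stress over `≍ τσ²` mean free times UNIFORMLY in `N` at fixed `σ³`, in exponential-moment
strength — is an open dynamical problem (it is the instance `u₀ = 0`, `F = φ v⁰v¹` of the crux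
`EquilibriumFastWindowLD`; reductions in `TwoClocksEquilibriumShearWindowLD.lean`). This file and its
companion `TwoClocksEquilibriumShearWindowLDCentring.lean` prove the STATIC facts that bracket it, for
every `N`, every flow and every window. Here, the upper side:

* `aemeasurable_comp_flow_prod` — observables evaluated along the flow are a.e.-measurable on
  `phase space × time` for every law carried by the good set (joint measurability of the flow on its
  good set, `HardSphereFlow.measurable_flow_prod_torus`) — the Tonelli/Fubini licence;
* `lintegral_exp_windowSum_le_static` — **Jensen in time + invariance** (`Λ_τ ≤ Λ_0`): for every
  continuous one-body `F`, `∫ exp(β ∑ᵢ w⁻¹∫₀ʷ F(Φ_r z i)) dG_N ≤ ∫ exp(β ∑ᵢ F(z i)) dG_N` — the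
  `τ → 0⁺` endpoint of the window monotonicity `Λ_{kτ} ≤ Λ_τ` of
  `TwoClocksEquilibriumShearWindowLDWindows.lean` (pathwise Jensen on the good set,
  `ofReal_exp_windowAverage_le`; Tonelli; stationarity `lintegral_comp_flow_localGibbsLaw_const`);
* the item's instances `shearWindowMoment_le_static` (`M_N(β,τ) ≤ M_N(β,0⁺)`, the static
  exponential moment of `∑ᵢ φ(xᵢ)vᵢ⁰vᵢ¹`) and `equilibriumShearWindowLD_apriori`
  (`M_N(β,τ) ≤ e^{c(β)(N+1)}` for `|β| ≤ β₀` and ALL `τ, N`: instance of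
  `kineticCurrentsWindowLD_apriori`) — time averaging can only help, and the window pressure is
  finite; the item asks that averaging helps all the way down to `e^{ε(N+1)}`.

References: S. Olla, S. R. S. Varadhan, H.-T. Yau, Comm. Math. Phys. 155 (1993) 523, §2
(exponential-moment currency of the one-block estimate); H. Spohn, *Large Scale Dynamics of
Interacting Particles* (1991), Part I §2.3 (invariance of the equilibrium measures).

prover-pitem-stmt-AtomisticToContinuum-14446-1.
-/

noncomputable section

open MeasureTheory Real Set
open scoped ENNReal

namespace Summit.AtomisticToContinuum.HydrodynamicLimit.Theorems

open Literature.Analysis.FluidPDE Literature.MathematicalPhysics.KineticTheory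

/-! ### Joint measurability on the good set: a.e.-measurability on products -/

/-- **Observables evaluated along the flow are a.e.-measurable on `phase space × time`.** For a
hard-sphere flow `Φ` on `𝕋³`, a measure `μ` on phase space carried by the good set, an s-finite
measure `ν` on `ℝ` and a measurable `H`, the map `(z, r) ↦ H (Φ_r z)` is `μ ⊗ ν`-a.e. measurable
(it is measurable on `Φ.good × ℝ` by `HardSphereFlow.measurable_flow_prod_torus`; modify it to a
constant off that conull measurable set). [folklore] -/
theorem aemeasurable_comp_flow_prod {ε : ℝ} {n : ℕ}
    (Φ : HardSphereFlow (Torus.geometry (Fin 3)) ε n) {μ : Measure (Config n (Fin 3) T3)}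
    (hμ : μ Φ.goodᶜ = 0) (ν : Measure ℝ) [SFinite ν] {β : Type*} [MeasurableSpace β] (b₀ : β)
    {H : Config n (Fin 3) T3 → β} (hH : Measurable H) :
    AEMeasurable (fun p : Config n (Fin 3) T3 × ℝ => H (Φ.flow p.2 p.1)) (μ.prod ν) := by
  classical
  -- adapted from `Cruxes/ShearStressHalfDrude/Disproof.lean` (`WO.integral_window_eq`)
  set S : Set (Config n (Fin 3) T3 × ℝ) := Φ.good ×ˢ (univ : Set ℝ) with hS
  have hSm : MeasurableSet S := Φ.measurableSet_good.prod MeasurableSet.univ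
  have hflowS : Measurable fun p : S => H (Φ.flow p.1.2 p.1.1) := by
    have hmk : Measurable fun p : S => ((⟨p.1.1, (mem_prod.1 p.2).1⟩ : Φ.good), p.1.2) :=
      ((measurable_fst.comp measurable_subtype_coe).subtype_mk).prodMk
        (measurable_snd.comp measurable_subtype_coe)
    exact hH.comp ((Φ.measurable_flow_prod_torus).comp hmk)
  set G : Config n (Fin 3) T3 × ℝ → β := fun p =>
    if hp : p ∈ S then H (Φ.flow p.2 p.1) else b₀ with hG
  have hGm : Measurable G := by
    have := Measurable.dite (s := S) (f := fun p : S => H (Φ.flow p.1.2 p.1.1))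
      (g := fun _ => b₀) hflowS measurable_const hSm
    convert this using 1
  have hSc : (μ.prod ν) Sᶜ = 0 := by
    have hsub : Sᶜ ⊆ Φ.goodᶜ ×ˢ (univ : Set ℝ) := by
      intro p hp
      simp only [hS, mem_compl_iff, mem_prod, mem_univ, and_true] at hp
      exact ⟨hp, mem_univ _⟩
    refine measure_mono_null hsub ?_
    rw [Measure.prod_prod, hμ, zero_mul]
  refine ⟨G, hGm, ?_⟩
  refine (ae_iff.2 (measure_mono_null (fun p hp => ?_) hSc))
  intro hpS
  exact hp (by simp only [hG, hpS, dite_true])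

/-! ### Jensen in time: the window exponential moment is at most the static one -/

/-- Jensen in time on a window, `lintegral` form: `exp (w⁻¹ ∫₀ʷ g) ≤ w⁻¹ ∫⁻_{(0,w]} exp g` for `g`
interval integrable on `[0, w]`, `0 < w` (Jensen for `exp` under the normalised Lebesgue measure
of the window). [folklore] -/
theorem ofReal_exp_windowAverage_le {g : ℝ → ℝ} {w : ℝ} (hw : 0 < w)
    (hg : IntervalIntegrable g volume 0 w) :
    ENNReal.ofReal (Real.exp (w⁻¹ * ∫ r in (0 : ℝ)..w, g r)) ≤
      ENNReal.ofReal w⁻¹ * ∫⁻ r in Ioc 0 w, ENNReal.ofReal (Real.exp (g r)) := by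
  -- adapted from the private `ofReal_exp_windowAvg_le` of
  -- `OneFlightGossipEngineKineticCurrentsWindowLDUniformJensenTimeSum.lean`
  set ν : Measure ℝ := ENNReal.ofReal w⁻¹ • volume.restrict (Ioc 0 w) with hν
  haveI : IsProbabilityMeasure ν := by
    constructor
    rw [hν, Measure.smul_apply, Measure.restrict_apply_univ, Real.volume_Ioc, sub_zero,
      smul_eq_mul, ← ENNReal.ofReal_mul (inv_nonneg.2 hw.le), inv_mul_cancel₀ hw.ne',
      ENNReal.ofReal_one]
  have hgν : Integrable g ν := hg.1.integrable.smul_measure ENNReal.ofReal_ne_top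
  have h1 : w⁻¹ * ∫ r in (0 : ℝ)..w, g r = ∫ r, g r ∂ν := by
    rw [intervalIntegral.integral_of_le hw.le, hν, integral_smul_measure,
      ENNReal.toReal_ofReal (inv_nonneg.2 hw.le), smul_eq_mul]
  have h2 : ∫⁻ r, ENNReal.ofReal (Real.exp (g r)) ∂ν =
      ENNReal.ofReal w⁻¹ * ∫⁻ r in Ioc 0 w, ENNReal.ofReal (Real.exp (g r)) := by
    rw [hν, lintegral_smul_measure, smul_eq_mul]
  rw [h1, ← h2]
  exact KineticFluxLdDecayTilt.ofReal_exp_integral_le_lintegral ν hgν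

/-- **Jensen in time + invariance: window exponential moments are dominated by the static one.**
Under the constant-profile (global canonical) Gibbs law `G_N = localGibbsLaw σ a u θ N Φ` — invariant
under every hard-sphere flow (`measurePreserving_flow_localGibbsLaw_const`) and carried by the good
set — for every continuous one-body observable `F`, every `β` and every window `w > 0`,
`∫ exp(β ∑ᵢ w⁻¹∫₀ʷ F(Φ_r z i) dr) dG_N ≤ ∫ exp(β ∑ᵢ F(z i)) dG_N`:
pathwise Jensen for `exp` in the time average (the orbit is interval integrable by energy
conservation), Tonelli (`aemeasurable_comp_flow_prod`), and stationarity of each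
single-time moment. This is the `τ → 0⁺` endpoint `Λ_τ ≤ Λ_0` of the window-monotonicity
`Λ_{kτ} ≤ Λ_τ` (`lintegral_exp_window_nat_mul_le`). [folklore] -/
theorem lintegral_exp_windowSum_le_static (σ a θ : ℝ) (u : V3) (N : ℕ)
    (Φ : HardSphereFlow (Torus.geometry (Fin 3)) (hsDiameter σ N) (N + 1))
    {F : T3 × V3 → ℝ} (hF : Continuous F) (β : ℝ) {w : ℝ} (hw : 0 < w) :
    ∫⁻ z, ENNReal.ofReal (Real.exp (β * ∑ i, w⁻¹ * ∫ r in (0 : ℝ)..w, F (Φ.flow r z i)))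
        ∂(localGibbsLaw σ (fun _ => a) (fun _ => u) (fun _ => θ) N Φ) ≤
      ∫⁻ z, ENNReal.ofReal (Real.exp (β * ∑ i, F (z i)))
        ∂(localGibbsLaw σ (fun _ => a) (fun _ => u) (fun _ => θ) N Φ) := by
  set μ := localGibbsLaw σ (fun _ => a) (fun _ => u) (fun _ => θ) N Φ with hμ
  have hgood : μ Φ.goodᶜ = 0 :=
    (localGibbsLaw_absolutelyContinuous σ _ _ _ N Φ) Φ.measure_compl_good
  -- the single-time integrand
  set H : Config (N + 1) (Fin 3) T3 → ℝ≥0∞ := fun z =>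
    ENNReal.ofReal (Real.exp (β * ∑ i, F (z i))) with hH
  have hHm : Measurable H := by
    refine (Measurable.const_mul (Finset.measurable_sum _ fun i _ => ?_) β).exp.ennreal_ofReal
    exact hF.measurable.comp (measurable_pi_apply i)
  -- Step 1: pathwise Jensen on the good set
  have hpt : ∀ z ∈ Φ.good,
      ENNReal.ofReal (Real.exp (β * ∑ i, w⁻¹ * ∫ r in (0 : ℝ)..w, F (Φ.flow r z i))) ≤
        ENNReal.ofReal w⁻¹ * ∫⁻ r in Ioc 0 w, H (Φ.flow r z) := by
    intro z hz
    -- a continuous observable along a good orbit is interval integrable: the orbit is measurable in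
    -- time and particle `i` stays in the compact `univ ×ˢ closedBall 0 √(2E(z))` (energy conservation)
    -- (as in `intervalIntegrable_comp_orbit`, `OneFlightGossipEngineKineticCurrentsWindowLDSplit.lean`)
    have hint : ∀ i, IntervalIntegrable (fun r => F (Φ.flow r z i)) volume 0 w := by
      intro i
      have hγ : Measurable fun t => Φ.flow t z := (Φ.isTrajectory z hz).measurable_torus
      have hm : Measurable fun r => F (Φ.flow r z i) :=
        hF.measurable.comp ((measurable_pi_apply i).comp hγ)
      set K : Set (T3 × V3) :=
        Set.univ ×ˢ Metric.closedBall (0 : V3) (Real.sqrt (2 * configEnergy z)) with hK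
      have hKc : IsCompact K := isCompact_univ.prod (isCompact_closedBall _ _)
      have hmem : ∀ r, Φ.flow r z i ∈ K := by
        intro r
        refine ⟨Set.mem_univ _, ?_⟩
        rw [Metric.mem_closedBall, dist_zero_right]
        refine Real.le_sqrt_of_sq_le ?_
        exact (norm_vel_sq_le_two_mul_configEnergy _ i).trans_eq (by rw [Φ.configEnergy_flow hz r])
      obtain ⟨B, hB⟩ := hKc.exists_bound_of_continuousOn hF.continuousOn
      exact (intervalIntegrable_const (c := B)).mono_fun' hm.aestronglyMeasurable
        (ae_of_all _ fun r => hB _ (hmem r))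
    have hsum : β * ∑ i, w⁻¹ * ∫ r in (0 : ℝ)..w, F (Φ.flow r z i) =
        w⁻¹ * ∫ r in (0 : ℝ)..w, β * ∑ i, F (Φ.flow r z i) := by
      rw [intervalIntegral.integral_const_mul, intervalIntegral.integral_finsetSum fun i _ => hint i,
        Finset.mul_sum, Finset.mul_sum, Finset.mul_sum]
      exact Finset.sum_congr rfl fun i _ => by ring
    have hgi : IntervalIntegrable (fun r => β * ∑ i, F (Φ.flow r z i)) volume 0 w := by
      have h1 : IntervalIntegrable (fun r => ∑ i, F (Φ.flow r z i)) volume 0 w := by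
        have := IntervalIntegrable.sum Finset.univ fun i (_ : i ∈ Finset.univ) => hint i
        rwa [Finset.sum_fn] at this
      exact h1.const_mul β
    rw [hsum]
    exact ofReal_exp_windowAverage_le hw hgi
  -- Step 2: integrate, Tonelli, stationarity
  have hae : ∀ᵐ z ∂μ, z ∈ Φ.good :=
    (measure_eq_zero_iff_ae_notMem.1 hgood).mono fun z hz => by simpa using hz
  haveI : SFinite μ := by
    -- instance shortcuts (the search for `SigmaFinite` on configuration spaces is deep)
    haveI hXE : SigmaFinite (volume : Measure (T3 × V3)) := inferInstance
    haveI hC : SigmaFinite (volume : Measure (Config (N + 1) (Fin 3) T3)) := inferInstance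
    simp only [hμ, localGibbsLaw, particleLaw_eq, liouville_eq]
    infer_instance
  have hswap : AEMeasurable (Function.uncurry fun (z : Config (N + 1) (Fin 3) T3) (r : ℝ) =>
      H (Φ.flow r z)) (μ.prod (volume.restrict (Ioc 0 w))) :=
    aemeasurable_comp_flow_prod Φ hgood _ (0 : ℝ≥0∞) hHm
  have hinv : ∀ r, ∫⁻ z, H (Φ.flow r z) ∂μ = ∫⁻ z, H z ∂μ := fun r =>
    lintegral_comp_flow_localGibbsLaw_const σ a θ u N Φ r hHm
  calc ∫⁻ z, ENNReal.ofReal (Real.exp (β * ∑ i, w⁻¹ * ∫ r in (0 : ℝ)..w, F (Φ.flow r z i))) ∂μ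
      ≤ ∫⁻ z, ENNReal.ofReal w⁻¹ * (∫⁻ r in Ioc 0 w, H (Φ.flow r z)) ∂μ := by
        refine lintegral_mono_ae ?_
        filter_upwards [hae] with z hz using hpt z hz
    _ = ENNReal.ofReal w⁻¹ * ∫⁻ r in Ioc 0 w, (∫⁻ z, H (Φ.flow r z) ∂μ) := by
        rw [lintegral_const_mul' _ _ ENNReal.ofReal_ne_top, lintegral_lintegral_swap hswap]
    _ = ENNReal.ofReal w⁻¹ * ∫⁻ _r in Ioc (0 : ℝ) w, (∫⁻ z, H z ∂μ) := by
        simp_rw [hinv]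
    _ = ∫⁻ z, H z ∂μ := by
        rw [setLIntegral_const, Real.volume_Ioc, sub_zero, mul_left_comm,
          ← ENNReal.ofReal_mul (inv_nonneg.2 hw.le), inv_mul_cancel₀ hw.ne', ENNReal.ofReal_one,
          mul_one]

/-! ### The instances for the item: the kinetic shear stress under the global Gibbs law -/

/-- **`Λ_τ(β) ≤ Λ_0(β)` for `EquilibriumShearWindowLD`** (stmt-AtomisticToContinuum-14446): under
the global Gibbs law `G_N = localGibbsLaw σ a₀ 0 θ₀ N Φ`, for every continuous `φ`, every `β`, every
`τ > 0`, every `N` and every hard-sphere flow, the window exponential moment of the kinetic shear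
stress `φ(x) v⁰ v¹` at window `τ(N+1)^{-1/3}` is at most the STATIC exponential moment
`∫ exp(β ∑ᵢ φ(xᵢ) vᵢ⁰ vᵢ¹) dG_N` (Jensen in time + invariance, `lintegral_exp_windowSum_le_static`).
Time averaging can only help; the item asks that it helps all the way down to `e^{ε(N+1)}`.
[folklore] -/
theorem shearWindowMoment_le_static (σ a₀ θ₀ : ℝ) (N : ℕ)
    (Φ : HardSphereFlow (Torus.geometry (Fin 3)) (hsDiameter σ N) (N + 1))
    {φ : T3 → ℝ} (hφ : Continuous φ) (β : ℝ) {τ : ℝ} (hτ : 0 < τ) :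
    ∫⁻ z, ENNReal.ofReal (Real.exp (β * ∑ i : Fin (N + 1),
        (τ * ((N : ℝ) + 1) ^ (-(1 / 3 : ℝ)))⁻¹ *
          ∫ r in (0 : ℝ)..(τ * ((N : ℝ) + 1) ^ (-(1 / 3 : ℝ))),
            φ (Φ.flow r z i).1 * ((Φ.flow r z i).2 0 * (Φ.flow r z i).2 1)))
        ∂(localGibbsLaw σ (fun _ => a₀) (fun _ => 0) (fun _ => θ₀) N Φ) ≤
      ∫⁻ z, ENNReal.ofReal (Real.exp (β * ∑ i : Fin (N + 1),
          φ (z i).1 * ((z i).2 0 * (z i).2 1)))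
        ∂(localGibbsLaw σ (fun _ => a₀) (fun _ => 0) (fun _ => θ₀) N Φ) := by
  have hw : 0 < τ * ((N : ℝ) + 1) ^ (-(1 / 3 : ℝ)) :=
    mul_pos hτ (Real.rpow_pos_of_pos (by positivity) _)
  have hF : Continuous fun y : T3 × V3 => φ y.1 * (y.2 0 * y.2 1) := by fun_prop
  exact lintegral_exp_windowSum_le_static σ a₀ θ₀ 0 N Φ hF β hw

/-- **A priori (β-linear) form of `EquilibriumShearWindowLD`** (stmt-AtomisticToContinuum-14446;
instance of `kineticCurrentsWindowLD_apriori`): for `a₀, θ₀ > 0`, `0 < σ ≤ 1/2`, every family of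
hard-sphere flows and every continuous `φ` there is `β₀ > 0` such that for `|β| ≤ β₀` some
`c = c(β)` bounds the window exponential moment by `exp(c(N+1))` for EVERY window parameter `τ > 0`
and EVERY `N` (statics: energy bound along good orbits + Gaussian velocity moments). The window
pressure of the item is thus finite at every `N`; the item's content is exactly the improvement
`c(β) ↦ ε` arbitrary as `τ → ∞` (open, dynamical). [folklore] -/
theorem equilibriumShearWindowLD_apriori {a₀ θ₀ : ℝ} (ha : 0 < a₀) (hθ : 0 < θ₀) {σ : ℝ}
    (hσ : 0 < σ) (hσ2 : σ ≤ 1 / 2)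
    (Φ : (N : ℕ) → HardSphereFlow (Torus.geometry (Fin 3)) (hsDiameter σ N) (N + 1))
    {φ : T3 → ℝ} (hφ : Continuous φ) :
    ∃ β₀ : ℝ, 0 < β₀ ∧ ∀ β : ℝ, |β| ≤ β₀ → ∃ c : ℝ, ∀ τ : ℝ, 0 < τ → ∀ N : ℕ,
      ∫⁻ z, ENNReal.ofReal (Real.exp (β * ∑ i : Fin (N + 1),
          (τ * ((N : ℝ) + 1) ^ (-(1 / 3 : ℝ)))⁻¹ *
            ∫ r in (0 : ℝ)..(τ * ((N : ℝ) + 1) ^ (-(1 / 3 : ℝ))),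
              φ ((Φ N).flow r z i).1 * (((Φ N).flow r z i).2 0 * ((Φ N).flow r z i).2 1)))
          ∂(localGibbsLaw σ (fun _ => a₀) (fun _ => 0) (fun _ => θ₀) N (Φ N)) ≤
        ENNReal.ofReal (Real.exp (c * ((N : ℝ) + 1))) := by
  -- quadratic growth `|φ(x) v⁰ v¹| ≤ ‖φ‖_∞ (1 + |v|²)` (as in `exists_shear_growth_bound`)
  obtain ⟨C, hC⟩ : ∃ C : ℝ, ∀ y : T3 × V3, |φ y.1 * (y.2 0 * y.2 1)| ≤ C * (1 + ‖y.2‖ ^ 2) := by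
    obtain ⟨C, hC⟩ := isCompact_univ.exists_bound_of_continuousOn (hφ.continuousOn (s := univ))
    refine ⟨C, fun y => ?_⟩
    have hφy : |φ y.1| ≤ C := by simpa [Real.norm_eq_abs] using hC y.1 (mem_univ _)
    have hC0 : 0 ≤ C := (abs_nonneg _).trans hφy
    have h0 : |y.2 0| ≤ ‖y.2‖ := by simpa [Real.norm_eq_abs] using PiLp.norm_apply_le y.2 0
    have h1 : |y.2 1| ≤ ‖y.2‖ := by simpa [Real.norm_eq_abs] using PiLp.norm_apply_le y.2 1
    have hv : |y.2 0 * y.2 1| ≤ 1 + ‖y.2‖ ^ 2 := by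
      rw [abs_mul]
      nlinarith [abs_nonneg (y.2 0), abs_nonneg (y.2 1), norm_nonneg y.2]
    rw [abs_mul]
    exact mul_le_mul hφy hv (abs_nonneg _) hC0
  exact kineticCurrentsWindowLD_apriori (fun _ => a₀) (fun _ => θ₀) (fun _ => 0) continuous_const
    continuous_const continuous_const (fun _ => ha) (fun _ => hθ) σ hσ hσ2 Φ
    (fun y => φ y.1 * (y.2 0 * y.2 1)) C hC

end Summit.AtomisticToContinuum.HydrodynamicLimit.Theorems

end
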